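import Mathlib.Analysis.InnerProductSpace.PiL2

/-!
# `StrictSplittingRule` (stmt-AtomisticToContinuum-12560): the ground-state (discrete Hardy) inequality on a finite weighted graph

Route `FreeSplittingCertificates`, crux r3 `StrictSplittingRule`, line `registered` (unit b2b-freesplit-B, gen 6).
The infinite-volume proof architecture of H12⋆ (`CoreJointCoercive`, …CoreJointDefs.lean; HOME CERT.md §14 (3),
FAR-LEMMA-SPEC.md) splits the sitewise ledger at the reference site `P` into a finite NEAR certificate and an analytic
FAR LEMMA.  In the far lemma the bare half-split Lennard-Jones second variation of a far bond `P–x` carries a NEGATIVE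
radial stiffness `≈ −(7/4)‖y_x − y_P‖⁻⁸·‖v_x‖²` (`stub_farPairLowerBound`), while the only positive currency a covariant
second-order table can move into `P`'s ledger are squared bond DIFFERENCES near `x`, weighted by an import family
`ω(‖y_x − y_P‖) ~ ‖y_x − y_P‖⁻⁶`.  Charging a potential `Σ_x w(x)·f(x)²` to a Dirichlet form `Σ_{edges} c_e (f_x − f_y)²`
with decaying weights is a DISCRETE WEIGHTED HARDY INEQUALITY; the classical mechanism that proves such inequalities with
explicit constants is the ground-state substitution: for any `φ ≥ 0` that is a supersolution, `(L_c φ)(x) ≥ w(x) φ(x)`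
where `(L_c φ)(x) = Σ_{y ∼ x} c_{xy} (φ(x) − φ(y))` is the weighted graph Laplacian, one has `Σ w f² ≤ Σ c (f_x − f_y)²`
for every `f` vanishing where `φ` does (the pinning `v_P = 0` of the co-rotated field is what admits `φ(P) = 0`).

This file records the brick for an arbitrary finite family of oriented edges `E ⊆ ι × ι` with weights `c ≥ 0`:

* `groundState_edge_eq` — the per-edge identity
  `c (f_x − f_y)² = c φ_x φ_y (f_x/φ_x − f_y/φ_y)² + c (φ_x − φ_y)(f_x²/φ_x − f_y²/φ_y)` (`φ_x, φ_y ≠ 0`);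
* `groundState_edge_le` — hence `c (φ_x − φ_y)(f_x²/φ_x − f_y²/φ_y) ≤ c (f_x − f_y)²` whenever `c, φ_x, φ_y ≥ 0` and
  `φ` is positive where `f` is nonzero (pinned ends `f = 0` may have `φ = 0`);
* `groundState_sum_vertex` — the edge sum regrouped by vertices: `Σ_e c_e (φ_{e₁} − φ_{e₂})(f²/φ|_{e₁} − f²/φ|_{e₂})
  = Σ_x (f_x²/φ_x)·(L_c φ)(x)`;
* `sum_mul_sq_le_dirichlet_of_supersolution` — the discrete Hardy inequality `Σ_x w_x f_x² ≤ Σ_e c_e (f_{e₁} − f_{e₂})²`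
  from a nonnegative supersolution `w φ ≤ L_c φ` (required only at vertices where `f ≠ 0`);
* `sum_mul_norm_sq_le_dirichlet_of_supersolution` — the same for vector fields `v : ι → ℝ³` (coordinatewise).

On the hcp exterior with `c ~ r⁻⁶` the power profile `φ = r^γ`, `0 < γ < 5`, is a supersolution with
`L_c φ / φ → γ(5 − γ) r⁻⁸` (continuum constant `(5/2)²` at `γ = 5/2`, the `(2/5)²` of FAR-LEMMA-SPEC §2 (ii)); verifying
it shell by shell is the next brick.  Structural bookkeeping ([folklore]: the ground-state representation of Dirichlet
forms); VALUE = a kernel-checked brick of the far lemma — NOT summit progress.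
-/

namespace Summit.AtomisticToContinuum.Crystallization.Theorems.StrictSplittingRuleBirth

open scoped BigOperators

/-- **Ground-state substitution, one edge.**  For `φ_x, φ_y ≠ 0`:
`c (f_x − f_y)² = c φ_x φ_y (f_x/φ_x − f_y/φ_y)² + c (φ_x − φ_y) (f_x²/φ_x − f_y²/φ_y)`. [folklore] -/
theorem groundState_edge_eq (c fx fy φx φy : ℝ) (hx : φx ≠ 0) (hy : φy ≠ 0) :
    c * (fx - fy) ^ 2 =
      c * (φx * φy) * (fx / φx - fy / φy) ^ 2 + c * (φx - φy) * (fx ^ 2 / φx - fy ^ 2 / φy) := by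
  field_simp
  ring

/-- **Ground-state substitution, one edge, as an inequality** (the transformed Dirichlet term is dropped): if
`c ≥ 0`, `φ_x, φ_y ≥ 0`, and `φ` is positive at each end where `f` is nonzero, then
`c (φ_x − φ_y) (f_x²/φ_x − f_y²/φ_y) ≤ c (f_x − f_y)²` (with Lean's `f²/0 = 0` at pinned ends). [folklore] -/
theorem groundState_edge_le {c fx fy φx φy : ℝ} (hc : 0 ≤ c) (hφx : 0 ≤ φx) (hφy : 0 ≤ φy)
    (hx : fx ≠ 0 → 0 < φx) (hy : fy ≠ 0 → 0 < φy) :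
    c * (φx - φy) * (fx ^ 2 / φx - fy ^ 2 / φy) ≤ c * (fx - fy) ^ 2 := by
  by_cases hfx : fx = 0
  · by_cases hfy : fy = 0
    · subst hfx; subst hfy; simp
    · have hφy' : 0 < φy := hy hfy
      subst hfx
      have h1 : c * (φx - φy) * (0 ^ 2 / φx - fy ^ 2 / φy) = c * fy ^ 2 - c * (φx * fy ^ 2 / φy) := by
        field_simp
        ring
      rw [h1]
      have h2 : 0 ≤ c * (φx * fy ^ 2 / φy) := by positivity
      nlinarith
  · have hφx' : 0 < φx := hx hfx
    by_cases hfy : fy = 0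
    · subst hfy
      have h1 : c * (φx - φy) * (fx ^ 2 / φx - 0 ^ 2 / φy) = c * fx ^ 2 - c * (φy * fx ^ 2 / φx) := by
        field_simp
        ring
      rw [h1]
      have h2 : 0 ≤ c * (φy * fx ^ 2 / φx) := by positivity
      nlinarith
    · have hφy' : 0 < φy := hy hfy
      rw [groundState_edge_eq c fx fy φx φy hφx'.ne' hφy'.ne']
      have h2 : 0 ≤ c * (φx * φy) * (fx / φx - fy / φy) ^ 2 := by positivity
      linarith

/-- **Summed over a finite family of oriented edges** (weights `c ≥ 0`, profile `φ ≥ 0` positive where `f ≠ 0` on the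
vertex set `V ⊇` all endpoints):
`Σ_{e ∈ E} c_e (φ_{e₁} − φ_{e₂}) (f_{e₁}²/φ_{e₁} − f_{e₂}²/φ_{e₂}) ≤ Σ_{e ∈ E} c_e (f_{e₁} − f_{e₂})²`. [folklore] -/
theorem groundState_sum_le {ι : Type*} (E : Finset (ι × ι)) (V : Finset ι) (c : ι × ι → ℝ) (f φ : ι → ℝ)
    (hE : ∀ e ∈ E, e.1 ∈ V ∧ e.2 ∈ V) (hc : ∀ e ∈ E, 0 ≤ c e) (hφ : ∀ x ∈ V, 0 ≤ φ x)
    (hfφ : ∀ x ∈ V, f x ≠ 0 → 0 < φ x) :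
    ∑ e ∈ E, c e * (φ e.1 - φ e.2) * (f e.1 ^ 2 / φ e.1 - f e.2 ^ 2 / φ e.2) ≤
      ∑ e ∈ E, c e * (f e.1 - f e.2) ^ 2 := by
  refine Finset.sum_le_sum fun e he => ?_
  obtain ⟨h1, h2⟩ := hE e he
  exact groundState_edge_le (hc e he) (hφ _ h1) (hφ _ h2) (hfφ _ h1) (hfφ _ h2)

/-- **Regrouping the edge sum by vertices.**  With the weighted graph Laplacian written out,
`(L_c φ)(x) = Σ_{e ∈ E, e₁ = x} c_e (φ_x − φ_{e₂}) + Σ_{e ∈ E, e₂ = x} c_e (φ_x − φ_{e₁})`, one has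
`Σ_{e ∈ E} c_e (φ_{e₁} − φ_{e₂}) (f_{e₁}²/φ_{e₁} − f_{e₂}²/φ_{e₂}) = Σ_{x ∈ V} (f_x²/φ_x) · (L_c φ)(x)` for every finite
`V` containing all endpoints. [folklore] -/
theorem groundState_sum_vertex {ι : Type*} [DecidableEq ι] (E : Finset (ι × ι)) (V : Finset ι) (c : ι × ι → ℝ)
    (f φ : ι → ℝ) (hE : ∀ e ∈ E, e.1 ∈ V ∧ e.2 ∈ V) :
    ∑ e ∈ E, c e * (φ e.1 - φ e.2) * (f e.1 ^ 2 / φ e.1 - f e.2 ^ 2 / φ e.2) =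
      ∑ x ∈ V, f x ^ 2 / φ x *
        ((∑ e ∈ E with e.1 = x, c e * (φ x - φ e.2)) + ∑ e ∈ E with e.2 = x, c e * (φ x - φ e.1)) := by
  -- split the edge sum into its two endpoint contributions
  have hsplit : ∑ e ∈ E, c e * (φ e.1 - φ e.2) * (f e.1 ^ 2 / φ e.1 - f e.2 ^ 2 / φ e.2) =
      (∑ e ∈ E, f e.1 ^ 2 / φ e.1 * (c e * (φ e.1 - φ e.2))) +
        ∑ e ∈ E, f e.2 ^ 2 / φ e.2 * (c e * (φ e.2 - φ e.1)) := by
    rw [← Finset.sum_add_distrib]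
    exact Finset.sum_congr rfl fun e _ => by ring
  rw [hsplit, Finset.sum_congr rfl fun x _ => mul_add _ _ _, Finset.sum_add_distrib]
  congr 1
  · -- group by the first endpoint
    rw [← Finset.sum_fiberwise_of_maps_to (s := E) (t := V) (g := fun e => e.1) fun e he => (hE e he).1]
    refine Finset.sum_congr rfl fun x _ => ?_
    rw [Finset.mul_sum]
    refine Finset.sum_congr rfl fun e he => ?_
    rw [(Finset.mem_filter.1 he).2]
  · -- group by the second endpoint
    rw [← Finset.sum_fiberwise_of_maps_to (s := E) (t := V) (g := fun e => e.2) fun e he => (hE e he).2]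
    refine Finset.sum_congr rfl fun x _ => ?_
    rw [Finset.mul_sum]
    refine Finset.sum_congr rfl fun e he => ?_
    rw [(Finset.mem_filter.1 he).2]

/-- **Discrete Hardy inequality from a supersolution (ground-state representation).**  Let `E` be a finite family
of oriented edges with weights `c_e ≥ 0` and endpoints in `V`, `φ ≥ 0` on `V`, positive wherever `f ≠ 0`, and
`w_x φ_x ≤ (L_c φ)(x)` at every vertex where `f_x ≠ 0`.  Then `Σ_{x ∈ V} w_x f_x² ≤ Σ_{e ∈ E} c_e (f_{e₁} − f_{e₂})²`.
(The far lemma uses it on the hcp exterior with `c ~ r⁻⁶`, `w ~ r⁻⁸`, `φ = r^γ`, pinned at `P`.) [folklore] -/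
theorem sum_mul_sq_le_dirichlet_of_supersolution {ι : Type*} [DecidableEq ι] (E : Finset (ι × ι)) (V : Finset ι)
    (c : ι × ι → ℝ) (f φ w : ι → ℝ) (hE : ∀ e ∈ E, e.1 ∈ V ∧ e.2 ∈ V) (hc : ∀ e ∈ E, 0 ≤ c e)
    (hφ : ∀ x ∈ V, 0 ≤ φ x) (hfφ : ∀ x ∈ V, f x ≠ 0 → 0 < φ x)
    (hsuper : ∀ x ∈ V, f x ≠ 0 → w x * φ x ≤
      (∑ e ∈ E with e.1 = x, c e * (φ x - φ e.2)) + ∑ e ∈ E with e.2 = x, c e * (φ x - φ e.1)) :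
    ∑ x ∈ V, w x * f x ^ 2 ≤ ∑ e ∈ E, c e * (f e.1 - f e.2) ^ 2 := by
  calc ∑ x ∈ V, w x * f x ^ 2
      ≤ ∑ x ∈ V, f x ^ 2 / φ x *
          ((∑ e ∈ E with e.1 = x, c e * (φ x - φ e.2)) + ∑ e ∈ E with e.2 = x, c e * (φ x - φ e.1)) := by
        refine Finset.sum_le_sum fun x hx => ?_
        by_cases hf : f x = 0
        · simp [hf]
        · have hφx : 0 < φ x := hfφ x hx hf
          have hq : 0 ≤ f x ^ 2 / φ x := by positivity
          calc w x * f x ^ 2 = f x ^ 2 / φ x * (w x * φ x) := by field_simp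
            _ ≤ _ := mul_le_mul_of_nonneg_left (hsuper x hx hf) hq
    _ = ∑ e ∈ E, c e * (φ e.1 - φ e.2) * (f e.1 ^ 2 / φ e.1 - f e.2 ^ 2 / φ e.2) :=
        (groundState_sum_vertex E V c f φ hE).symm
    _ ≤ ∑ e ∈ E, c e * (f e.1 - f e.2) ^ 2 := groundState_sum_le E V c f φ hE hc hφ hfφ

/-- **Vector version** (coordinatewise): for `v : ι → ℝ³` and a nonnegative supersolution `w φ ≤ L_c φ` valid where
`v ≠ 0`, with `φ > 0` wherever `v ≠ 0`: `Σ_{x ∈ V} w_x ‖v_x‖² ≤ Σ_{e ∈ E} c_e ‖v_{e₁} − v_{e₂}‖²`. [folklore] -/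
theorem sum_mul_norm_sq_le_dirichlet_of_supersolution {ι : Type*} [DecidableEq ι] (E : Finset (ι × ι))
    (V : Finset ι) (c : ι × ι → ℝ) (v : ι → EuclideanSpace ℝ (Fin 3)) (φ w : ι → ℝ)
    (hE : ∀ e ∈ E, e.1 ∈ V ∧ e.2 ∈ V) (hc : ∀ e ∈ E, 0 ≤ c e) (hφ : ∀ x ∈ V, 0 ≤ φ x)
    (hvφ : ∀ x ∈ V, v x ≠ 0 → 0 < φ x)
    (hsuper : ∀ x ∈ V, v x ≠ 0 → w x * φ x ≤
      (∑ e ∈ E with e.1 = x, c e * (φ x - φ e.2)) + ∑ e ∈ E with e.2 = x, c e * (φ x - φ e.1)) :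
    ∑ x ∈ V, w x * ‖v x‖ ^ 2 ≤ ∑ e ∈ E, c e * ‖v e.1 - v e.2‖ ^ 2 := by
  -- expand the norms coordinatewise and apply the scalar inequality to each coordinate
  have hn : ∀ z : EuclideanSpace ℝ (Fin 3), ‖z‖ ^ 2 = ∑ i, z i ^ 2 := fun z => by
    rw [EuclideanSpace.norm_eq, Real.sq_sqrt (Finset.sum_nonneg fun i _ => sq_nonneg _)]
    exact Finset.sum_congr rfl fun i _ => by rw [Real.norm_eq_abs, sq_abs]
  have hne : ∀ x ∈ V, ∀ i, v x i ≠ 0 → v x ≠ 0 := fun x _ i hi hv => hi (by rw [hv]; rfl)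
  calc ∑ x ∈ V, w x * ‖v x‖ ^ 2 = ∑ x ∈ V, ∑ i, w x * (v x i) ^ 2 := by
        refine Finset.sum_congr rfl fun x _ => ?_
        rw [hn, Finset.mul_sum]
    _ = ∑ i, ∑ x ∈ V, w x * (v x i) ^ 2 := Finset.sum_comm
    _ ≤ ∑ i, ∑ e ∈ E, c e * (v e.1 i - v e.2 i) ^ 2 := by
        refine Finset.sum_le_sum fun i _ => ?_
        exact sum_mul_sq_le_dirichlet_of_supersolution E V c (fun x => v x i) φ w hE hc hφ
          (fun x hx hi => hvφ x hx (hne x hx i hi)) (fun x hx hi => hsuper x hx (hne x hx i hi))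
    _ = ∑ e ∈ E, ∑ i, c e * (v e.1 i - v e.2 i) ^ 2 := Finset.sum_comm
    _ = ∑ e ∈ E, c e * ‖v e.1 - v e.2‖ ^ 2 := by
        refine Finset.sum_congr rfl fun e _ => ?_
        rw [hn, Finset.mul_sum]
        exact Finset.sum_congr rfl fun i _ => by rw [PiLp.sub_apply]

end Summit.AtomisticToContinuum.Crystallization.Theorems.StrictSplittingRuleBirth
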